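import Literature.Analysis.FunctionSpaces.TorusGevreyCompactness
import HarnessLib

/-!
# Compactness of Gevrey balls on `T³` (tools stub `stub_gevreyCompactnessTools`, block N-E10,
# line `ergodic-budget-selection-closing`, crux `BaireTransfer.DenseLoudDesignerForces`,
# stmt-AnomalousDissipation-1143)

Summit-side specialisation to `T³ = UnitAddTorus (Fin 3)` of the Literature theorem
`Torus.exists_smooth_limit_of_gevrey_bound` (`Literature/Analysis/FunctionSpaces/TorusGevreyCompactness.lean`):
a sequence `vₙ` of smooth, divergence-free, mean-zero fields on `T³` with a UNIFORM Gevrey bound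
`∑_{k∈S} e^{2σ|k|} ‖v̂ₙ(k)‖² ≤ C` (`σ > 0`, all finite `S ⊆ ℤ³`, `v̂ₙ = 𝓕(complexify ∘ vₙ)`; the output of the
Gevrey smoothing tools E9) has a subsequence converging in `H¹` — `∫ ‖v_{ψ n} − w‖² → 0` and
`‖∇(v_{ψ n} − w)‖₂² → 0` — to a smooth, divergence-free, mean-zero field `w` obeying the same Gevrey bound.
Proof (in the Literature file): modewise bounds `‖v̂ₙ(k)‖² ≤ C e^{−2σ|k|}` and diagonal extraction over the
countable lattice (`Lattice.exists_strictMono_forall_tendsto_apply`), Gevrey decay ⇒ rapid decay so the limit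
family synthesises a smooth field (`Torus.RapidDecay.isSmooth_fourierSynth`, real by conjugation symmetry),
divergence-freeness / zero mean / the Gevrey bound pass to the limit modewise, and
`∑ₖ (1 + |k|²) ‖v̂_{ψ n}(k) − ŵ(k)‖² → 0` by Tannery's theorem with the summable majorant
`4C(1 + |k|²)e^{−2σ|k|}` (Parseval for `‖·‖₂²` and `‖∇·‖₂²`).  Used with E9 to make limits of solution slices
SMOOTH data (E7: `V`-data existence by approximation; N-P: closedness of the enlarged phase).  The registered
tools stub `stub_gevreyCompactnessTools` is proved BY NAME with exactly the registered signature.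

References: Foias–Temam, *Gevrey class regularity for the solutions of the Navier–Stokes equations*,
J. Funct. Anal. 87 (1989); Warner, *Foundations of Differentiable Manifolds and Lie Groups* (GTM 94, 1983)
Lemma 6.23; Grafakos, *Classical Fourier Analysis* (3rd ed., 2014) Props. 3.2.5, 3.2.7.
-/

-- `Summit.<Summit>.<Problem>` is the tree's mandated summit-side namespace (CONVENTIONS §2); for this
-- single-conjunct summit the two coincide, so the duplicate is deliberate.
set_option linter.dupNamespace false

noncomputable section

open scoped BigOperators Topology ENNReal InnerProductSpace
open Filter Set Function MeasureTheory

namespace Summit.AnomalousDissipation.AnomalousDissipation.Theorems.DenseLoudDesignerForces.Ergodic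

-- The line preamble also opens `Literature.Analysis.FluidPDE(.Torus)`; no FluidPDE file is imported here
-- (pure Fourier analysis), and every name below lives in `Literature.Analysis.FunctionSpaces.Torus`.
open Literature.Analysis.FunctionSpaces Literature.Analysis.FunctionSpaces.Torus

/-- **Tools stub E10 of block N (`stub_gevreyCompactnessTools`, crux stmt-AnomalousDissipation-1143, line
`ergodic-budget-selection-closing`) — compactness of Gevrey balls (the limit datum of the approximation
scheme is smooth).**  A sequence of smooth divergence-free mean-zero fields on `T³` with a UNIFORM Gevrey
bound `∑_{k∈S} e^{2σ|k|}‖v̂ₙ(k)‖² ≤ C` (`σ > 0`) has a subsequence converging in `H¹` (`L²` and `‖∇·‖₂²`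
of the difference `→ 0`) to a smooth divergence-free mean-zero field obeying the same Gevrey bound
(`Torus.exists_smooth_limit_of_gevrey_bound` at `d = Fin 3`: coefficientwise compactness and a diagonal
subsequence over the countable lattice, Fourier synthesis of the rapidly decaying conjugate-symmetric
limit family, modewise passage to the limit of the constraints and of the bound, and dominated convergence
(Tannery) with the summable majorant `4C(1 + |k|²)e^{−2σ|k|}` for `∑ₖ (1 + |k|²)‖v̂ₙ(k) − ŵ(k)‖²`).
[folklore] -/
theorem stub_gevreyCompactnessTools {σ C : ℝ} (hσ : 0 < σ) (v : ℕ → (UnitAddTorus (Fin 3)) → (EuclideanSpace ℝ (Fin 3)))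
    (hv : ∀ n, IsSmooth (v n)) (hdiv : ∀ n, IsDivFree (v n)) (hmean : ∀ n, HasZeroMean (v n))
    (hG : ∀ n, ∀ S : Finset (Fin 3 → ℤ), ∑ k ∈ S, Real.exp (2 * σ * Real.sqrt (freqNormSq k)) *
      ‖UnitAddTorus.mFourierCoeff (EuclideanSpace.complexify ∘ v n) k‖ ^ 2 ≤ C) :
    ∃ (w : (UnitAddTorus (Fin 3)) → (EuclideanSpace ℝ (Fin 3))) (ψ : ℕ → ℕ), StrictMono ψ ∧ IsSmooth w ∧ IsDivFree w ∧ HasZeroMean w ∧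
      (∀ S : Finset (Fin 3 → ℤ), ∑ k ∈ S, Real.exp (2 * σ * Real.sqrt (freqNormSq k)) *
        ‖UnitAddTorus.mFourierCoeff (EuclideanSpace.complexify ∘ w) k‖ ^ 2 ≤ C) ∧
      Tendsto (fun n => ∫ x, ‖v (ψ n) x - w x‖ ^ 2) atTop (𝓝 0) ∧
      Tendsto (fun n => gradNormSq (v (ψ n) - w)) atTop (𝓝 0) :=
  exists_smooth_limit_of_gevrey_bound hσ v hv hdiv hmean hG

end Summit.AnomalousDissipation.AnomalousDissipation.Theorems.DenseLoudDesignerForces.Ergodic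

end
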